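import Summits.NavierStokesRegularity.NavierStokesRegularity.Theorems.ScenarioCensusSteadyS6
import Summits.NavierStokesRegularity.NavierStokesRegularity.Theorems.ScenarioCensusPeriodicSlabHelical
import HarnessLib

/-!
# Blow-up scenario census, block S: row S6d (helical, SMALL period–Reynolds number) — census decl and closers

Cell `pub/ns-census` (`SCENARIO-CENSUS.md` v1.46 NEW ROW S6d; corollary row since v1.54; lead §6 «one-liner
`Row_S6d` + `row_S6d_excluded` (:= `PeriodicSlab.helical_liouville_small`)»), typer seat `ns-census-typer-1`
(generation 5).  Row S6d = row S6's class VERBATIM (the binders of the fact `HanWangXie2023_helical_liouville`: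
`ν > 0`, pitch `κ ≠ 0`, `IsLerayProfile ν 0 U P`, `U, P ∈ C^∞`, `IsHelicallySymmetric κ U`) with the bound
sharpened to `∃ M < ν/|κ|, ∀ x, ‖U x‖ ≤ M` (period–Reynolds number `2π|κ|·sup‖U‖/ν < 2π`) ⇒ `U ≡ C e₃`.
Two closers, both tree theorems BY NAME: the direct small-`Re_P` proof `PeriodicSlab.helical_liouville_small`
(typer-2 g6, sharp Wirtinger + dyadic Saint-Venant via BGWX Thm 1.4 (d); `row_S6d_excluded`) and the parent row S6
(ANY `Re_P`, Han–Wang–Xie Thm 1.1, `row_S6_excluded`; `row_S6d_of_row_S6`, `row_S6d_excluded'`).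

No summit statement is proved here; nothing in this file is a claim about NS regularity beyond those statements.
-/

-- the summit and its single problem share the name (D-0017 nested layout)
set_option linter.dupNamespace false

noncomputable section

open scoped ContDiff

namespace Summit.NavierStokesRegularity.NavierStokesRegularity.Theorems.ScenarioCensus

open Literature.Analysis Literature.Analysis.FluidPDE

/-- Census row S6d — (steady · HELICAL, pitch `κ ≠ 0` · BOUNDED smooth steady solutions on `ℝ³`, any `ν > 0`, with
SMALL period–Reynolds number `∃ M < ν/|κ|, sup ‖U‖ ≤ M`): `U ≡ C e₃`.  Row S6's binders (the fact
`HanWangXie2023_helical_liouville`) verbatim with the bound sharpened.  Value: EXCLUDED-IN-TREE (corollary row of S6;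
own direct proof `PeriodicSlab.helical_liouville_small`). -/
def Row_S6d : Prop :=
  ∀ ν : ℝ, 0 < ν → ∀ κ : ℝ, κ ≠ 0 →
    ∀ (U : EuclideanSpace ℝ (Fin 3) → EuclideanSpace ℝ (Fin 3)) (P : EuclideanSpace ℝ (Fin 3) → ℝ),
      IsLerayProfile ν 0 U P → ContDiff ℝ (⊤ : ℕ∞) U → ContDiff ℝ (⊤ : ℕ∞) P →
      (∃ M : ℝ, M < ν / |κ| ∧ ∀ x, ‖U x‖ ≤ M) → IsHelicallySymmetric κ U →
        ∃ C : ℝ, U = fun _ => C • eZ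

/-- Row S6d is EXCLUDED-IN-TREE by its own direct proof: `PeriodicSlab.helical_liouville_small` (axial period
`2π|κ|`, so `ν/|κ| = 2πν/L` and row S7d's `PeriodicSlab.periodicSlab_liouville_small` — Bang–Gui–Wang–Xie 2025
Thm 1.4 (d) — makes `U` constant; a helically symmetric constant is axial). -/
theorem row_S6d_excluded : Row_S6d :=
  fun _ν hν _κ hκ _U _P hprof hU hP hbd hsym => PeriodicSlab.helical_liouville_small hν hκ hprof hU hP hbd hsym

/-- Lattice: S6 (any period–Reynolds number) ⇒ S6d (small period–Reynolds number). -/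
theorem row_S6d_of_row_S6 (h : Row_S6) : Row_S6d :=
  fun ν hν κ hκ U P hprof hU hP hbd hsym =>
    h ν hν κ hκ U P hprof hU hP (hbd.imp fun _ hM => hM.2) hsym

/-- Row S6d is also closed through its parent row S6 (`row_S6_excluded`, Han–Wang–Xie 2023 Thm 1.1 in the tree via
`HelicalSlab.helical_liouville`). -/
theorem row_S6d_excluded' : Row_S6d := row_S6d_of_row_S6 row_S6_excluded

end Summit.NavierStokesRegularity.NavierStokesRegularity.Theorems.ScenarioCensus

end
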